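import Summits.NavierStokesRegularity.NavierStokesRegularity.Theorems.AdaptedFrequencyFrequencyRigidityMildFrameDriftWindow
import Literature.Analysis.FluidPDE.OseenDuhamelPairCalculus
import Literature.Analysis.FluidPDE.SelfSimilar
import HarnessLib

/-!
# Crux `FrequencyRigidity` (stmt-NavierStokesRegularity-2955), line `two-ended-pinning`,
# stub S3a `stub_ancientDriftNormalForm` — KNSS's Lemma 3.1 on the whole ancient interval

Helper file (lands `--supports stmt-NavierStokesRegularity-2955`; theorems only) proving the registered stub
`stub_ancientDriftNormalForm` of skeleton v6 of the line: a classical Navier–Stokes flow `(u, p)` (viscosity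
`1`, zero force) on `ℝ³ × (−∞,0)` with the global time-Type-I bound `‖u(t,x)‖ ≤ C/√(−t)` admits an
`ℝ³`-valued drift `β`, continuous on `(−∞,0)`, with `‖β(t)‖ ≤ (8C + 32 C₀ C²)/√(−t)`
(`C₀ = oseenSliceConst ℝ³`) and the intrinsic drift identity
`u(t,y) − e^{(t−s)Δ}u(s)(y) + B¹_s(u,u)(t)(y) = β(t) − β(s)` for all `s < t < 0` and all `y`.

Proof.  The landed window lemma `MovingAdjointBernoulli.mildFrame_continuousDrift_window` gives, on every
window `(a, b) ⊂ (−∞, 0)` (where `u` is bounded by `C/√(−b)`), a continuous window drift with this identity;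
hence the DEFECT `D(s,t)(y) := u(t,y) − e^{(t−s)Δ}u(s)(y) + B¹_s(u,u)(t)(y)` is spatially constant and a
cocycle, `D(r,t) = D(r,s) + D(s,t)`.  The Type-I bound gives the pair estimate
`‖D(s',s)‖ ≤ 2C/√(−s) + 2C₀ (C/√(−s))² √(s − s')` (`norm_heatExtension_le`, `norm_oseenDuhamel_le_const`),
so `‖D(4t, t)‖ ≤ K/√(−t)` with `K = 2C + 4C₀C²`, the sequence `n ↦ D(4ⁿ⁺¹t, t)` has geometrically
decaying increments (ratio `1/2`) and converges to some `β(t)` with `‖β(t)‖ ≤ 2K/√(−t)`; since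
`D(4ⁿ⁺¹t, t) − D(4ⁿ⁺¹s, s) = D(s,t) − D(4ⁿ⁺¹s, 4ⁿ⁺¹t)` and `‖D(4ⁿ⁺¹s, 4ⁿ⁺¹t)‖ = O(2^{−n})` by the same
pair estimate, `β(t) − β(s) = D(s,t)`; continuity of `β` is local (`β = β(s₀) + D(s₀, ·)` near `t₀`, and
`D(s₀, ·)` is an increment of a continuous window drift).

## References

* G. Koch, N. Nadirashvili, G. Seregin, V. Šverák, *Liouville theorems for the Navier–Stokes equations and
  applications*, Acta Math. 203 (2009) 83–105 = arXiv:0709.3599, §1 p. 3, §3 Lemma 3.1 and Remark 3.1,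
  §4 p. 8. [KochNadirashviliSereginSverak2009]
-/

set_option linter.dupNamespace false

noncomputable section

namespace Summit.NavierStokesRegularity.NavierStokesRegularity.Theorems.FrequencyRigidity.TwoEndedPinning

open Literature.Analysis Literature.Analysis.FluidPDE MeasureTheory Set Filter Topology Function

/-- The Type-I constant of a Type-I field is nonnegative (evaluate at `t = −1`). [folklore] -/
private theorem typeI_nonneg {C : ℝ} {u : ℝ → EuclideanSpace ℝ (Fin 3) → EuclideanSpace ℝ (Fin 3)}
    (hTI : HasTypeITimeDecay C u) : 0 ≤ C := by
  have h1 := hTI (-1) (by norm_num) 0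
  rw [neg_neg, Real.sqrt_one, div_one] at h1
  exact (norm_nonneg _).trans h1

/-- `√(−4ⁿt) = 2ⁿ √(−t)`. [folklore] -/
private theorem sqrt_neg_four_pow_mul (n : ℕ) (t : ℝ) :
    Real.sqrt (-((4 : ℝ) ^ n * t)) = 2 ^ n * Real.sqrt (-t) := by
  have h4 : (4 : ℝ) ^ n = (2 ^ n) ^ 2 := by rw [sq, ← mul_pow]; norm_num
  rw [h4, show -(((2 : ℝ) ^ n) ^ 2 * t) = ((2 : ℝ) ^ n) ^ 2 * (-t) by ring,
    Real.sqrt_mul (by positivity) (-t), Real.sqrt_sq (by positivity)]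

/-- **The window drift, read on the abstract defect.**  On every window `(a, b)`, `b < 0`, a Type-I classical
ancient flow is bounded by `C/√(−b)`, so the landed window lemma
`MovingAdjointBernoulli.mildFrame_continuousDrift_window` provides a continuous window drift `β_W` with
`D(s,t)(y) = β_W(t) − β_W(s)` for `a < s < t < b`. [cite: KochNadirashviliSereginSverak2009, §3 Lemma 3.1 and Remark 3.1 (arXiv:0709.3599 p. 7)] -/
private theorem window_defect {C : ℝ}
    {u : ℝ → EuclideanSpace ℝ (Fin 3) → EuclideanSpace ℝ (Fin 3)} {p : ℝ → EuclideanSpace ℝ (Fin 3) → ℝ}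
    (h : IsClassicalNSSolutionOn (Iio 0) 1 0 u p) (hTI : HasTypeITimeDecay C u)
    (D : ℝ → ℝ → EuclideanSpace ℝ (Fin 3) → EuclideanSpace ℝ (Fin 3))
    (hD : ∀ s t y, D s t y =
      u t y - UnboundedOperators.heatExtension (u s) (t - s) y + oseenDuhamel 1 s u u t y)
    {a b : ℝ} (hab : a < b) (hb : b < 0) :
    ∃ βW : ℝ → EuclideanSpace ℝ (Fin 3), ContinuousOn βW (Ioo a b) ∧
      ∀ s t : ℝ, a < s → s < t → t < b → ∀ y : EuclideanSpace ℝ (Fin 3), D s t y = βW t - βW s := by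
  have hC : 0 ≤ C := typeI_nonneg hTI
  obtain ⟨K, hK⟩ :=
    MovingAdjointBernoulli.mildFrame_continuousDrift_window (C / Real.sqrt (-b)) (b - a) (sub_pos.2 hab)
  have hK' := hK a u p
  have hab' : a + (b - a) = b := by ring
  simp only [hab'] at hK'
  have hwin : IsClassicalNSSolutionOn (Ioo a b) 1 0 u p :=
    h.mono (fun τ hτ => mem_Iio.2 (lt_trans hτ.2 hb)) isOpen_Ioo.uniqueDiffOn
  have hsq : 0 < Real.sqrt (-b) := Real.sqrt_pos.2 (neg_pos.2 hb)
  have hbd : ∀ t ∈ Ioo a b, ∀ x : EuclideanSpace ℝ (Fin 3), ‖u t x‖ ≤ C / Real.sqrt (-b) :=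
      fun t ht x =>
    (hTI t (lt_trans ht.2 hb) x).trans
      (div_le_div_of_nonneg_left hC hsq (Real.sqrt_le_sqrt (by linarith [ht.2])))
  obtain ⟨βW, hc, -, hi⟩ := hK' hwin hbd
  exact ⟨βW, hc, fun s t hs hst ht y => by rw [hD]; exact hi s t hs hst ht y⟩

/-- **The defect is spatially constant** (`D(s,t)(y) = D(s,t)(0)`): both sides of the window identity on
`(s − 1, t/2)` have the same `y`-independent right-hand side. [cite: KochNadirashviliSereginSverak2009, §3 Lemma 3.1 (arXiv:0709.3599 p. 7)] -/
private theorem defect_const {C : ℝ}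
    {u : ℝ → EuclideanSpace ℝ (Fin 3) → EuclideanSpace ℝ (Fin 3)} {p : ℝ → EuclideanSpace ℝ (Fin 3) → ℝ}
    (h : IsClassicalNSSolutionOn (Iio 0) 1 0 u p) (hTI : HasTypeITimeDecay C u)
    (D : ℝ → ℝ → EuclideanSpace ℝ (Fin 3) → EuclideanSpace ℝ (Fin 3))
    (hD : ∀ s t y, D s t y =
      u t y - UnboundedOperators.heatExtension (u s) (t - s) y + oseenDuhamel 1 s u u t y)
    {s t : ℝ} (hst : s < t) (ht : t < 0) (y : EuclideanSpace ℝ (Fin 3)) : D s t y = D s t 0 := by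
  obtain ⟨βW, -, hi⟩ := window_defect h hTI D hD (a := s - 1) (b := t / 2) (by linarith) (by linarith)
  rw [hi s t (by linarith) hst (by linarith) y, hi s t (by linarith) hst (by linarith) 0]

/-- **The defect is a cocycle** (`D(r,t) = D(r,s) + D(s,t)` for `r < s < t < 0`): evaluate the window identity
on the single window `(r − 1, t/2)` containing the three times. [cite: KochNadirashviliSereginSverak2009, §3 Lemma 3.1 (arXiv:0709.3599 p. 7)] -/
private theorem defect_cocycle {C : ℝ}
    {u : ℝ → EuclideanSpace ℝ (Fin 3) → EuclideanSpace ℝ (Fin 3)} {p : ℝ → EuclideanSpace ℝ (Fin 3) → ℝ}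
    (h : IsClassicalNSSolutionOn (Iio 0) 1 0 u p) (hTI : HasTypeITimeDecay C u)
    (D : ℝ → ℝ → EuclideanSpace ℝ (Fin 3) → EuclideanSpace ℝ (Fin 3))
    (hD : ∀ s t y, D s t y =
      u t y - UnboundedOperators.heatExtension (u s) (t - s) y + oseenDuhamel 1 s u u t y)
    {r s t : ℝ} (hrs : r < s) (hst : s < t) (ht : t < 0) : D r t 0 = D r s 0 + D s t 0 := by
  obtain ⟨βW, -, hi⟩ := window_defect h hTI D hD (a := r - 1) (b := t / 2) (by linarith) (by linarith)
  rw [hi r t (by linarith) (hrs.trans hst) (by linarith) 0, hi r s (by linarith) hrs (by linarith) 0,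
    hi s t (by linarith) hst (by linarith) 0]
  abel

/-- **The pair estimate** (KNSS 2009 §4 p. 8 arithmetic): for `s' < s < 0`,
`‖D(s',s)(0)‖ ≤ ‖u(s,0)‖ + ‖e^{(s−s')Δ}u(s')(0)‖ + ‖B¹_{s'}(u,u)(s)(0)‖ ≤ 2C/√(−s) + C₀ (C/√(−s))² · 2√(s − s')`
by the Type-I slab bound `‖u(τ)‖ ≤ C/√(−s)` for `τ ≤ s`, the maximum principle `norm_heatExtension_le` and the
bilinear bound `norm_oseenDuhamel_le_const`. [cite: KochNadirashviliSereginSverak2009, §4 p. 8 (arXiv:0709.3599)] -/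
private theorem defect_pair_le {C : ℝ}
    {u : ℝ → EuclideanSpace ℝ (Fin 3) → EuclideanSpace ℝ (Fin 3)} {p : ℝ → EuclideanSpace ℝ (Fin 3) → ℝ}
    (_h : IsClassicalNSSolutionOn (Iio 0) 1 0 u p) (hTI : HasTypeITimeDecay C u)
    (D : ℝ → ℝ → EuclideanSpace ℝ (Fin 3) → EuclideanSpace ℝ (Fin 3))
    (hD : ∀ s t y, D s t y =
      u t y - UnboundedOperators.heatExtension (u s) (t - s) y + oseenDuhamel 1 s u u t y)
    {s' s : ℝ} (hs' : s' < s) (hs : s < 0) :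
    ‖D s' s 0‖ ≤ 2 * (C / Real.sqrt (-s)) +
      oseenSliceConst (EuclideanSpace ℝ (Fin 3)) * (C / Real.sqrt (-s) * (C / Real.sqrt (-s))) *
        (2 * Real.sqrt (s - s')) := by
  have hC : 0 ≤ C := typeI_nonneg hTI
  have hsq : 0 < Real.sqrt (-s) := Real.sqrt_pos.2 (neg_pos.2 hs)
  have hslab : ∀ τ : ℝ, τ ≤ s → ∀ y : EuclideanSpace ℝ (Fin 3), ‖u τ y‖ ≤ C / Real.sqrt (-s) :=
      fun τ hτ y =>
    (hTI τ (by linarith) y).trans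
      (div_le_div_of_nonneg_left hC hsq (Real.sqrt_le_sqrt (by linarith)))
  have h1 : ‖u s 0‖ ≤ C / Real.sqrt (-s) := hslab s le_rfl 0
  have h2 : ‖UnboundedOperators.heatExtension (u s') (s - s') 0‖ ≤ C / Real.sqrt (-s) :=
    UnboundedOperators.norm_heatExtension_le (fun z => hslab s' hs'.le z) (sub_pos.2 hs') 0
  have h3 : ‖oseenDuhamel 1 s' u u s 0‖ ≤
      oseenSliceConst (EuclideanSpace ℝ (Fin 3)) * (C / Real.sqrt (-s) * (C / Real.sqrt (-s))) *
        (2 * Real.sqrt (s - s')) :=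
    norm_oseenDuhamel_le_const hs'.le (fun τ hτ y => hslab τ hτ.2.le y)
      (fun τ hτ y => hslab τ hτ.2.le y) 0
  rw [hD]
  calc ‖u s 0 - UnboundedOperators.heatExtension (u s') (s - s') 0 + oseenDuhamel 1 s' u u s 0‖
      ≤ ‖u s 0 - UnboundedOperators.heatExtension (u s') (s - s') 0‖ + ‖oseenDuhamel 1 s' u u s 0‖ :=
        norm_add_le _ _
    _ ≤ ‖u s 0‖ + ‖UnboundedOperators.heatExtension (u s') (s - s') 0‖ + ‖oseenDuhamel 1 s' u u s 0‖ :=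
        add_le_add (norm_sub_le _ _) le_rfl
    _ ≤ _ := by linarith

/-- **One scaling step**: `‖D(4t, t)(0)‖ ≤ (2C + 4C₀C²)/√(−t)` for `t < 0` (the pair estimate with
`2√(t − 4t) = 2√(−3t) ≤ 4√(−t)`; exactly the arithmetic of the tree's `smallConstantLiouville_step`).
[cite: KochNadirashviliSereginSverak2009, §4 p. 8 (arXiv:0709.3599)] -/
private theorem defect_step_le {C : ℝ}
    {u : ℝ → EuclideanSpace ℝ (Fin 3) → EuclideanSpace ℝ (Fin 3)} {p : ℝ → EuclideanSpace ℝ (Fin 3) → ℝ}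
    (h : IsClassicalNSSolutionOn (Iio 0) 1 0 u p) (hTI : HasTypeITimeDecay C u)
    (D : ℝ → ℝ → EuclideanSpace ℝ (Fin 3) → EuclideanSpace ℝ (Fin 3))
    (hD : ∀ s t y, D s t y =
      u t y - UnboundedOperators.heatExtension (u s) (t - s) y + oseenDuhamel 1 s u u t y)
    {t : ℝ} (ht : t < 0) :
    ‖D (4 * t) t 0‖ ≤ (2 * C + 4 * oseenSliceConst (EuclideanSpace ℝ (Fin 3)) * C ^ 2) / Real.sqrt (-t) := by
  have h4t : 4 * t < t := by linarith
  have hnt : 0 < -t := neg_pos.2 ht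
  have hsq : 0 < Real.sqrt (-t) := Real.sqrt_pos.2 hnt
  have hsq' : Real.sqrt (-t) ≠ 0 := hsq.ne'
  have hC : 0 ≤ C := typeI_nonneg hTI
  have hC₀ : 0 < oseenSliceConst (EuclideanSpace ℝ (Fin 3)) := oseenSliceConst_pos
  have hts : Real.sqrt (t - 4 * t) ≤ 2 * Real.sqrt (-t) := by
    rw [show t - 4 * t = 3 * (-t) by ring]
    calc Real.sqrt (3 * (-t)) ≤ Real.sqrt (2 ^ 2 * (-t)) := Real.sqrt_le_sqrt (by nlinarith)
      _ = 2 * Real.sqrt (-t) := by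
          rw [Real.sqrt_mul (by norm_num), Real.sqrt_sq (by norm_num : (0 : ℝ) ≤ 2)]
  have hsq_sq : Real.sqrt (-t) ^ 2 = -t := Real.sq_sqrt hnt.le
  calc ‖D (4 * t) t 0‖
      ≤ 2 * (C / Real.sqrt (-t)) +
          oseenSliceConst (EuclideanSpace ℝ (Fin 3)) * (C / Real.sqrt (-t) * (C / Real.sqrt (-t))) *
            (2 * Real.sqrt (t - 4 * t)) := defect_pair_le h hTI D hD h4t ht
    _ ≤ 2 * (C / Real.sqrt (-t)) +
          oseenSliceConst (EuclideanSpace ℝ (Fin 3)) * (C / Real.sqrt (-t) * (C / Real.sqrt (-t))) *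
            (2 * (2 * Real.sqrt (-t))) := by gcongr
    _ = (2 * C + 4 * oseenSliceConst (EuclideanSpace ℝ (Fin 3)) * C ^ 2) / Real.sqrt (-t) := by
        field_simp
        ring

/-- **Geometric decay of the increments**: for `t < 0` and every `n`,
`dist (D(4ⁿ⁺¹t, t)(0)) (D(4ⁿ⁺²t, t)(0)) = ‖D(4ⁿ⁺²t, 4ⁿ⁺¹t)(0)‖ ≤ K/√(−4ⁿ⁺¹t) = (K/(2√(−t)))·(1/2)ⁿ`
(`K = 2C + 4C₀C²`; cocycle + scaling step). [cite: KochNadirashviliSereginSverak2009, §4 p. 8 (arXiv:0709.3599)] -/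
private theorem defect_dist_succ_le {C : ℝ}
    {u : ℝ → EuclideanSpace ℝ (Fin 3) → EuclideanSpace ℝ (Fin 3)} {p : ℝ → EuclideanSpace ℝ (Fin 3) → ℝ}
    (h : IsClassicalNSSolutionOn (Iio 0) 1 0 u p) (hTI : HasTypeITimeDecay C u)
    (D : ℝ → ℝ → EuclideanSpace ℝ (Fin 3) → EuclideanSpace ℝ (Fin 3))
    (hD : ∀ s t y, D s t y =
      u t y - UnboundedOperators.heatExtension (u s) (t - s) y + oseenDuhamel 1 s u u t y)
    {t : ℝ} (ht : t < 0) (n : ℕ) :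
    dist (D (4 ^ (n + 1) * t) t 0) (D (4 ^ (n + 1 + 1) * t) t 0) ≤
      (2 * C + 4 * oseenSliceConst (EuclideanSpace ℝ (Fin 3)) * C ^ 2) / (2 * Real.sqrt (-t)) * (1 / 2) ^ n := by
  have hsq : 0 < Real.sqrt (-t) := Real.sqrt_pos.2 (neg_pos.2 ht)
  have hsq' : Real.sqrt (-t) ≠ 0 := hsq.ne'
  have h41 : (1 : ℝ) < 4 ^ (n + 1) := one_lt_pow₀ (by norm_num) (by omega)
  have ht't : (4 : ℝ) ^ (n + 1) * t < t := by nlinarith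
  have ht'0 : (4 : ℝ) ^ (n + 1) * t < 0 := by linarith
  have h44 : (4 : ℝ) ^ (n + 1 + 1) * t = 4 * (4 ^ (n + 1) * t) := by ring
  have hco := defect_cocycle h hTI D hD (by linarith : 4 * ((4 : ℝ) ^ (n + 1) * t) < 4 ^ (n + 1) * t)
    ht't ht
  rw [h44, dist_eq_norm, hco,
    show D (4 ^ (n + 1) * t) t 0 - (D (4 * (4 ^ (n + 1) * t)) (4 ^ (n + 1) * t) 0 + D (4 ^ (n + 1) * t) t 0)
      = -D (4 * (4 ^ (n + 1) * t)) (4 ^ (n + 1) * t) 0 by abel, norm_neg]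
  refine (defect_step_le h hTI D hD ht'0).trans (le_of_eq ?_)
  rw [sqrt_neg_four_pow_mul, one_div_pow]
  have h2 : (2 : ℝ) ^ n ≠ 0 := by positivity
  field_simp
  ring

/-- **Same-ratio pairs vanish at `−∞`**: for `s < t < 0`, `D(4ⁿ⁺¹s, 4ⁿ⁺¹t)(0) → 0` as `n → ∞` (the pair
estimate at the scaled times is `(1/2)ⁿ⁺¹ · (2C/√(−t) + 2C₀C²√(t−s)/(−t))`).
[cite: KochNadirashviliSereginSverak2009, §4 p. 8 (arXiv:0709.3599)] -/
private theorem defect_scaled_tendsto_zero {C : ℝ}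
    {u : ℝ → EuclideanSpace ℝ (Fin 3) → EuclideanSpace ℝ (Fin 3)} {p : ℝ → EuclideanSpace ℝ (Fin 3) → ℝ}
    (h : IsClassicalNSSolutionOn (Iio 0) 1 0 u p) (hTI : HasTypeITimeDecay C u)
    (D : ℝ → ℝ → EuclideanSpace ℝ (Fin 3) → EuclideanSpace ℝ (Fin 3))
    (hD : ∀ s t y, D s t y =
      u t y - UnboundedOperators.heatExtension (u s) (t - s) y + oseenDuhamel 1 s u u t y)
    {s t : ℝ} (hst : s < t) (ht : t < 0) :
    Tendsto (fun n : ℕ => D (4 ^ (n + 1) * s) (4 ^ (n + 1) * t) 0) atTop (𝓝 0) := by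
  have hnt : 0 < -t := neg_pos.2 ht
  have hsq : 0 < Real.sqrt (-t) := Real.sqrt_pos.2 hnt
  have hsq' : Real.sqrt (-t) ≠ 0 := hsq.ne'
  set M : ℝ := 2 * C / Real.sqrt (-t) +
    2 * oseenSliceConst (EuclideanSpace ℝ (Fin 3)) * C ^ 2 * Real.sqrt (t - s) / Real.sqrt (-t) ^ 2 with hM
  have hbound : ∀ n : ℕ, ‖D (4 ^ (n + 1) * s) (4 ^ (n + 1) * t) 0‖ ≤ M * (1 / 2) ^ (n + 1) := by
    intro n
    have hμ0 : (0 : ℝ) < 2 ^ (n + 1) := by positivity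
    have hμ' : (2 : ℝ) ^ (n + 1) ≠ 0 := hμ0.ne'
    have h4 : (4 : ℝ) ^ (n + 1) = (2 ^ (n + 1)) ^ 2 := by rw [sq, ← mul_pow]; norm_num
    have hlt : (4 : ℝ) ^ (n + 1) * s < 4 ^ (n + 1) * t := mul_lt_mul_of_pos_left hst (by positivity)
    have hneg : (4 : ℝ) ^ (n + 1) * t < 0 := mul_neg_of_pos_of_neg (by positivity) ht
    have key := defect_pair_le h hTI D hD hlt hneg
    have hs1 : Real.sqrt (-((4 : ℝ) ^ (n + 1) * t)) = 2 ^ (n + 1) * Real.sqrt (-t) :=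
      sqrt_neg_four_pow_mul (n + 1) t
    have hs2 : Real.sqrt ((4 : ℝ) ^ (n + 1) * t - 4 ^ (n + 1) * s) = 2 ^ (n + 1) * Real.sqrt (t - s) := by
      rw [h4, show ((2 : ℝ) ^ (n + 1)) ^ 2 * t - ((2 : ℝ) ^ (n + 1)) ^ 2 * s
          = ((2 : ℝ) ^ (n + 1)) ^ 2 * (t - s) by ring,
        Real.sqrt_mul (by positivity) (t - s), Real.sqrt_sq hμ0.le]
    rw [hs1, hs2] at key
    refine key.trans (le_of_eq ?_)
    rw [hM, one_div_pow]
    field_simp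
  have htend : Tendsto (fun n : ℕ => M * (1 / 2 : ℝ) ^ (n + 1)) atTop (𝓝 0) := by
    have h1 : Tendsto (fun n : ℕ => (1 / 2 : ℝ) ^ (n + 1)) atTop (𝓝 0) :=
      (tendsto_pow_atTop_nhds_zero_of_lt_one (by norm_num) (by norm_num)).comp (tendsto_add_atTop_nat 1)
    simpa using h1.const_mul M
  exact squeeze_zero_norm hbound htend

/-- **The normalised ancient drift, on the abstract defect.**  With `β(t) := limₙ D(4ⁿ⁺¹t, t)(0)` (a Cauchy
sequence with geometric increments, `defect_dist_succ_le`): `‖β(t)‖ ≤ (4C + 8C₀C²)/√(−t) ≤ (8C + 32C₀C²)/√(−t)`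
(`dist_le_of_le_geometric_of_tendsto₀`), `β(t) − β(s) = D(s,t)(0) = D(s,t)(y)` (cocycle twice and
`defect_scaled_tendsto_zero`), and `β` is continuous on `(−∞,0)` (locally `β = β(s₀) + β_W − β_W(s₀)` for a
continuous window drift `β_W`). [cite: KochNadirashviliSereginSverak2009, §1 p. 3, §3 Lemma 3.1 and Remark 3.1 (arXiv:0709.3599)] -/
private theorem ancientDrift_of_defect {C : ℝ}
    {u : ℝ → EuclideanSpace ℝ (Fin 3) → EuclideanSpace ℝ (Fin 3)} {p : ℝ → EuclideanSpace ℝ (Fin 3) → ℝ}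
    (h : IsClassicalNSSolutionOn (Iio 0) 1 0 u p) (hTI : HasTypeITimeDecay C u)
    (D : ℝ → ℝ → EuclideanSpace ℝ (Fin 3) → EuclideanSpace ℝ (Fin 3))
    (hD : ∀ s t y, D s t y =
      u t y - UnboundedOperators.heatExtension (u s) (t - s) y + oseenDuhamel 1 s u u t y) :
    ∃ β : ℝ → EuclideanSpace ℝ (Fin 3), ContinuousOn β (Iio 0) ∧
      (∀ t : ℝ, t < 0 →
        ‖β t‖ ≤ (8 * C + 32 * oseenSliceConst (EuclideanSpace ℝ (Fin 3)) * C ^ 2) / Real.sqrt (-t)) ∧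
      ∀ s t : ℝ, s < t → t < 0 → ∀ y : EuclideanSpace ℝ (Fin 3), D s t y = β t - β s := by
  have hC : 0 ≤ C := typeI_nonneg hTI
  have hC₀ : 0 < oseenSliceConst (EuclideanSpace ℝ (Fin 3)) := oseenSliceConst_pos
  set K : ℝ := 2 * C + 4 * oseenSliceConst (EuclideanSpace ℝ (Fin 3)) * C ^ 2 with hK
  -- ## the approximating sequences and their limits
  set f : ℝ → ℕ → EuclideanSpace ℝ (Fin 3) := fun t n => D (4 ^ (n + 1) * t) t 0 with hf
  have hdist : ∀ t : ℝ, t < 0 → ∀ n : ℕ,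
      dist (f t n) (f t (n + 1)) ≤ K / (2 * Real.sqrt (-t)) * (1 / 2) ^ n :=
    fun t ht n => defect_dist_succ_le h hTI D hD ht n
  have hcs : ∀ t : ℝ, t < 0 → CauchySeq (f t) := fun t ht =>
    cauchySeq_of_le_geometric (1 / 2) _ (by norm_num) (hdist t ht)
  set β : ℝ → EuclideanSpace ℝ (Fin 3) := fun t => limUnder atTop (f t) with hβ
  have hlim : ∀ t : ℝ, t < 0 → Tendsto (f t) atTop (𝓝 (β t)) := fun t ht =>
    (hcs t ht).tendsto_limUnder
  -- ## the identity at the origin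
  have hid0 : ∀ s t : ℝ, s < t → t < 0 → D s t 0 = β t - β s := by
    intro s t hst ht
    have hs : s < 0 := hst.trans ht
    have h1 : Tendsto (fun n => f t n - f s n) atTop (𝓝 (β t - β s)) := (hlim t ht).sub (hlim s hs)
    have hev : ∀ᶠ n : ℕ in atTop,
        D s t 0 - D (4 ^ (n + 1) * s) (4 ^ (n + 1) * t) 0 = f t n - f s n := by
      have hpow : Tendsto (fun n : ℕ => (4 : ℝ) ^ (n + 1)) atTop atTop :=
        (tendsto_pow_atTop_atTop_of_one_lt (by norm_num : (1 : ℝ) < 4)).comp (tendsto_add_atTop_nat 1)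
      filter_upwards [hpow.eventually_gt_atTop (s / t)] with n hn
      have hn' : (4 : ℝ) ^ (n + 1) * t < s := (div_lt_iff_of_neg ht).1 hn
      have hr'r : (4 : ℝ) ^ (n + 1) * s < 4 ^ (n + 1) * t := mul_lt_mul_of_pos_left hst (by positivity)
      have hc1 := defect_cocycle h hTI D hD hn' hst ht
      have hc2 := defect_cocycle h hTI D hD hr'r hn' hs
      simp only [hf]
      rw [hc1, hc2]
      abel
    have h2 : Tendsto (fun n => f t n - f s n) atTop (𝓝 (D s t 0 - 0)) :=
      (tendsto_const_nhds.sub (defect_scaled_tendsto_zero h hTI D hD hst ht)).congr' hev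
    rw [sub_zero] at h2
    exact tendsto_nhds_unique h2 h1
  refine ⟨β, fun t₀ ht₀ => ?_, fun t ht => ?_,
    fun s t hst ht y => (defect_const h hTI D hD hst ht y).trans (hid0 s t hst ht)⟩
  · -- ## continuity at `t₀ < 0`: locally `β = β(s₀) + β_W - β_W(s₀)`, `s₀ = t₀ - 1`
    have ht₀' : t₀ < 0 := ht₀
    have hs₀ : t₀ - 1 < t₀ := by linarith
    obtain ⟨βW, hβWc, hβW⟩ :=
      window_defect h hTI D hD (a := t₀ - 2) (b := t₀ / 2) (by linarith) (by linarith)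
    have hev : (fun t => β (t₀ - 1) + (βW t - βW (t₀ - 1))) =ᶠ[𝓝 t₀] β := by
      filter_upwards [Ioo_mem_nhds hs₀ (by linarith : t₀ < t₀ / 2)] with t ht
      rw [← hβW (t₀ - 1) t (by linarith) ht.1 ht.2 0, hid0 (t₀ - 1) t ht.1 (ht.2.trans (by linarith))]
      abel
    have hca : ContinuousAt (fun t => β (t₀ - 1) + (βW t - βW (t₀ - 1))) t₀ :=
      continuousAt_const.add
        ((hβWc.continuousAt (Ioo_mem_nhds (by linarith) (by linarith))).sub continuousAt_const)
    exact (hca.congr hev).continuousWithinAt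
  · -- ## the bound `‖β t‖ ≤ 2K/√(-t) ≤ (8C + 32C₀C²)/√(-t)`
    have hnt : 0 < -t := neg_pos.2 ht
    have hsq : 0 < Real.sqrt (-t) := Real.sqrt_pos.2 hnt
    have hsq' : Real.sqrt (-t) ≠ 0 := hsq.ne'
    have hf0 : ‖f t 0‖ ≤ K / Real.sqrt (-t) := by
      show ‖D (4 ^ (0 + 1) * t) t 0‖ ≤ K / Real.sqrt (-t)
      rw [zero_add, pow_one]
      exact defect_step_le h hTI D hD ht
    have hd : dist (f t 0) (β t) ≤ K / (2 * Real.sqrt (-t)) / (1 - 1 / 2) :=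
      dist_le_of_le_geometric_of_tendsto₀ (1 / 2) (K / (2 * Real.sqrt (-t))) (by norm_num)
        (hdist t ht) (hlim t ht)
    calc ‖β t‖ = ‖f t 0 + (β t - f t 0)‖ := by rw [add_sub_cancel]
      _ ≤ ‖f t 0‖ + ‖β t - f t 0‖ := norm_add_le _ _
      _ = ‖f t 0‖ + dist (f t 0) (β t) := by rw [dist_comm, dist_eq_norm]
      _ ≤ K / Real.sqrt (-t) + K / (2 * Real.sqrt (-t)) / (1 - 1 / 2) := add_le_add hf0 hd
      _ = (4 * C + 8 * oseenSliceConst (EuclideanSpace ℝ (Fin 3)) * C ^ 2) / Real.sqrt (-t) := by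
          rw [hK]
          field_simp
          ring
      _ ≤ (8 * C + 32 * oseenSliceConst (EuclideanSpace ℝ (Fin 3)) * C ^ 2) / Real.sqrt (-t) := by
          apply div_le_div_of_nonneg_right _ hsq.le
          have hCC : 0 ≤ oseenSliceConst (EuclideanSpace ℝ (Fin 3)) * C ^ 2 := mul_nonneg hC₀.le (sq_nonneg C)
          nlinarith

/-- **Stub S3a `stub_ancientDriftNormalForm` of skeleton v6 of line `two-ended-pinning`** (registered signature
verbatim) — KNSS's Lemma 3.1 on the WHOLE ancient interval with the drift normalised at `t → −∞`: a classical
Navier–Stokes flow `(u, p)` (viscosity `1`, zero force) on `ℝ³ × (−∞,0)` with the global time-Type-I bound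
`‖u(t,x)‖ ≤ C/√(−t)` admits a drift `β`, continuous on `(−∞,0)`, with `‖β(t)‖ ≤ (8C + 32C₀C²)/√(−t)` and
`u(t,y) − e^{(t−s)Δ}u(s)(y) + B¹_s(u,u)(t)(y) = β(t) − β(s)` for all `s < t < 0`, all `y`.
[cite: KochNadirashviliSereginSverak2009, §1 p. 3, §3 Lemma 3.1 and Remark 3.1, §4 p. 8 (arXiv:0709.3599)] -/
theorem stub_ancientDriftNormalForm :
    ∀ (C : ℝ) (u : ℝ → EuclideanSpace ℝ (Fin 3) → EuclideanSpace ℝ (Fin 3))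
      (p : ℝ → EuclideanSpace ℝ (Fin 3) → ℝ),
      Literature.Analysis.FluidPDE.IsClassicalNSSolutionOn (Set.Iio 0) 1 0 u p →
      Literature.Analysis.FluidPDE.HasTypeITimeDecay C u →
      ∃ β : ℝ → EuclideanSpace ℝ (Fin 3), ContinuousOn β (Set.Iio 0) ∧
        (∀ t : ℝ, t < 0 → ‖β t‖ ≤
          (8 * C + 32 * Literature.Analysis.FluidPDE.oseenSliceConst (EuclideanSpace ℝ (Fin 3)) * C ^ 2) /
            Real.sqrt (-t)) ∧
        ∀ s t : ℝ, s < t → t < 0 → ∀ y : EuclideanSpace ℝ (Fin 3),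
          u t y - Literature.Analysis.UnboundedOperators.heatExtension (u s) (t - s) y +
              Literature.Analysis.FluidPDE.oseenDuhamel 1 s u u t y = β t - β s := by
  intro C u p h hTI
  obtain ⟨β, hβc, hβb, hβi⟩ := ancientDrift_of_defect h hTI
    (fun s t y => u t y - UnboundedOperators.heatExtension (u s) (t - s) y + oseenDuhamel 1 s u u t y)
    (fun _ _ _ => rfl)
  exact ⟨β, hβc, hβb, fun s t hst ht y => hβi s t hst ht y⟩

end Summit.NavierStokesRegularity.NavierStokesRegularity.Theorems.FrequencyRigidity.TwoEndedPinning

end
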